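import Mathlib
import HarnessLib
import Summits.Ventures.LatticeQCDFlow.Exactness.SphereLatticeLuscherKernel
import Summits.Ventures.LatticeQCDFlow.TrivializingMaps.PoissonSolver

/-!
# Solvability of Lüscher's Poisson problem `−Σ_k ∂̃_k·∂̃_k X = R + Ċ` on the lattice of spheres in a finite-dimensional `𝔏₀`-stable space

HONEST FRAMING: exact (Metropolis-corrected) sampling algorithms for lattice gauge theory;
figures of merit are autocorrelation/cost numbers at stated couplings and volumes; no
continuum-physics claim.

Venture `LatticeQCDFlow` (cell pub-lqcd), topic `Exactness`; FANOUT row 7 (`s0-cpn-null`).  NEW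
WORK of the cell over Mathlib and the tree's `Exactness/SphereLatticeLuscherKernel.lean` (null
space of `𝔏₀` = constants), `Exactness/SphereLatticeGreen.lean` (`∫ 𝔏₀F dP = 0`) and
`Exactness/SphereSiteLaplacianCalculus.lean` (linearity of `∂̃_k·∂̃_k`); the rank–nullity scheme
is ADAPTED FROM the tree's gauge-side `TrivializingMaps/PoissonSolver.lean` (theory-1, `SU(n)^E`;
its codimension-one lemma `finrank_ker_add_one_of_apply_ne_zero` is reused by import);
nothing is cited as a fact.  Printed counterpart, NAMED ONLY: M. Lüscher, Commun. Math. Phys. 293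
(2010) 899, §3.3, §4.3–§4.4 (each order of the flow action is obtained by inverting the Laplacian
on the orthogonal complement of the constants, for polynomial actions "by linear algebra" in a
finite-dimensional invariant space); Engel–Schaefer, Comput. Phys. Commun. 182 (2011) 2107, §3.

Setting: `E` a finite-dimensional real inner product space, `dim E ≥ 2`; `Λ` finite;
`Ω = Λ → S(E)` read in `Λ → E` through `n ↦ (ω n : E)`; `P = ⊗_Λ σ`, `σ = volume.toSphere`;
`P ≤ ((Λ → E) → ℝ)` a finite-dimensional subspace of `C²` functionals containing the constants
and STABLE UNDER `𝔏₀` ON THE SPHERES (for `f ∈ P` some `g ∈ P` has `Σ_k ∂̃_k·∂̃_k f = g` on `Ω`).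

* `restrictΩ`, `lapΩ`, `P0`, `T0`, `rho0`, `rhoP`, `meanV`, `evalV`, `oneV` — the rank–nullity
  cast; `siteLaplacian_sphereConfig_eq_zero_of_forall` (`𝔏₀` on `Ω` only sees `f|_Ω`);
  **`ker_T0_eq`** (on `P₀ = {f ∈ P | f(ω₀) = 0}`: `𝔏₀f = 0` on `Ω` iff `f = 0` on `Ω`);
  **`range_T0_eq`** (`range T₀ =` the mean-zero part of `P|_Ω`).
* **`exists_sum_siteLaplacian_eq_sub_mean`**, **`exists_luscher_poisson_solution`** — for every
  `R ∈ P` there are `X ∈ P` and `c ∈ ℝ` (`c = −⨍R dP`) with `−Σ_k ∂̃_k·∂̃_k X = R + c` on the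
  product of unit spheres: LÜSCHER'S RECURSION IS SOLVABLE ORDER BY ORDER INSIDE ANY SUCH `P`
  (uniquely up to constants, `SphereLatticeLuscherKernel.luscher_poisson_unique`).

NOT CLAIMED: a concrete `𝔏₀`-stable polynomial space containing the Engel–Schaefer action and
the sources of all orders (orders `0`, `1` are solved in closed form in `SphereLOFlowAction` /
`SphereNLOFlowAction`; the general polynomial instance is not built here); anything quantitative.
-/

noncomputable section

namespace Summit.Ventures.LatticeQCDFlow.Exactness

open NormedSpace Function MeasureTheory Metric InnerProductSpace Laplacian Filter Set
open scoped RealInnerProductSpace Topology ENNReal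

variable {E : Type*} [NormedAddCommGroup E] [InnerProductSpace ℝ E] [FiniteDimensional ℝ E]
  [MeasurableSpace E] [BorelSpace E]
variable {Λ : Type*} [Fintype Λ] [DecidableEq Λ]

/-! ## §1 Restriction to the product of spheres; `𝔏₀` there only sees the restriction -/
section Restrict

variable (E Λ) in
/-- Restriction of ambient functionals to the product of unit spheres (`f ↦ f ∘ coe`), linear. -/
def restrictΩ : ((Λ → E) → ℝ) →ₗ[ℝ] ((Λ → sphere (0 : E) 1) → ℝ) where
  toFun f ω := f (fun n => (ω n : E))
  map_add' _ _ := rfl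
  map_smul' _ _ := rfl

omit [InnerProductSpace ℝ E] [FiniteDimensional ℝ E] [MeasurableSpace E] [BorelSpace E] [Fintype Λ] [DecidableEq Λ] in
/-- Unfolding `restrictΩ`. -/
@[simp] theorem restrictΩ_apply (f : (Λ → E) → ℝ) (ω : Λ → sphere (0 : E) 1) :
    restrictΩ E Λ f ω = f (fun n => (ω n : E)) := rfl

omit [MeasurableSpace E] [BorelSpace E] [Fintype Λ] in
/-- **`𝔏₀` on the spheres only sees the restriction**: if `f = 0` on the product of unit spheres then
`∂̃_k·∂̃_k f = 0` there (the site section `y ↦ f(ω[k ← y/‖y‖])` vanishes off the origin). -/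
theorem siteLaplacian_sphereConfig_eq_zero_of_forall {f : (Λ → E) → ℝ}
    (hf : ∀ ω : Λ → sphere (0 : E) 1, f (fun n => (ω n : E)) = 0) (k : Λ)
    (ω : Λ → sphere (0 : E) 1) : siteLaplacian k f (fun n => (ω n : E)) = 0 := by
  unfold siteLaplacian
  have hx0 : (ω k : E) ≠ 0 := sphereConfig_ne_zero ω k
  have hev : (fun y : E => f (update (fun n => (ω n : E)) k (normalize y))) =ᶠ[𝓝 (ω k : E)]
      fun _ => (0 : ℝ) := by
    filter_upwards [isOpen_compl_singleton.mem_nhds hx0] with y hy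
    have hy0 : y ≠ 0 := hy
    have hmem : normalize y ∈ sphere (0 : E) 1 := by
      simp [norm_normalize_eq_one_iff.2 hy0]
    have h := hf (update ω k ⟨normalize y, hmem⟩)
    rw [sphereConfig_update] at h
    exact h
  rw [(laplacian_congr_nhds hev).eq_of_nhds]
  simp [InnerProductSpace.laplacian_eq_iteratedFDeriv_stdOrthonormalBasis]

omit [MeasurableSpace E] [BorelSpace E] in
/-- Summed form: `f = 0` on the product of unit spheres ⇒ `Σ_k ∂̃_k·∂̃_k f = 0` there. -/
theorem sum_siteLaplacian_sphereConfig_eq_zero_of_forall {f : (Λ → E) → ℝ}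
    (hf : ∀ ω : Λ → sphere (0 : E) 1, f (fun n => (ω n : E)) = 0) (ω : Λ → sphere (0 : E) 1) :
    ∑ k, siteLaplacian k f (fun n => (ω n : E)) = 0 :=
  Finset.sum_eq_zero fun k _ => siteLaplacian_sphereConfig_eq_zero_of_forall hf k ω

end Restrict

/-! ## §2 The rank–nullity cast (adapted from `TrivializingMaps/PoissonSolver`) -/
section Solver

variable (P : Submodule ℝ ((Λ → E) → ℝ)) (ω₀ : Λ → sphere (0 : E) 1)

omit [MeasurableSpace E] [BorelSpace E] in
/-- Additivity of `Σ_k ∂̃_k·∂̃_k` on `C²` functionals, on the product of unit spheres. -/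
theorem sum_siteLaplacian_add_sphereConfig {f g : (Λ → E) → ℝ} (hf : ContDiff ℝ 2 f)
    (hg : ContDiff ℝ 2 g) (ω : Λ → sphere (0 : E) 1) :
    ∑ k, siteLaplacian k (fun x => f x + g x) (fun n => (ω n : E)) =
      ∑ k, siteLaplacian k f (fun n => (ω n : E)) + ∑ k, siteLaplacian k g (fun n => (ω n : E)) := by
  rw [← Finset.sum_add_distrib]
  refine Finset.sum_congr rfl fun k _ => ?_
  exact siteLaplacian_add (G := f) (H := g) (x := fun n => (ω n : E)) (n := k)
    (sphereConfig_ne_zero ω k) (hf.comp (contDiff_update 2 _ k)) (hg.comp (contDiff_update 2 _ k))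

omit [MeasurableSpace E] [BorelSpace E] in
/-- Homogeneity of `Σ_k ∂̃_k·∂̃_k` on `C²` functionals, on the product of unit spheres. -/
theorem sum_siteLaplacian_const_mul_sphereConfig {f : (Λ → E) → ℝ} (hf : ContDiff ℝ 2 f) (c : ℝ)
    (ω : Λ → sphere (0 : E) 1) :
    ∑ k, siteLaplacian k (fun x => c * f x) (fun n => (ω n : E)) =
      c * ∑ k, siteLaplacian k f (fun n => (ω n : E)) := by
  rw [Finset.mul_sum]
  refine Finset.sum_congr rfl fun k _ => ?_
  exact siteLaplacian_const_mul (G := f) (x := fun n => (ω n : E)) (n := k)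
    (sphereConfig_ne_zero ω k) (hf.comp (contDiff_update 2 _ k)) c

omit [MeasurableSpace E] [BorelSpace E] in
/-- **`𝔏₀|_Ω` as a linear map on a space of `C²` functionals**: `f ↦ (ω ↦ Σ_k ∂̃_k·∂̃_k f(ω))`. -/
def lapΩ (hs : ∀ f ∈ P, ContDiff ℝ 2 f) : P →ₗ[ℝ] ((Λ → sphere (0 : E) 1) → ℝ) where
  toFun f ω := ∑ k, siteLaplacian k (f : (Λ → E) → ℝ) (fun n => (ω n : E))
  map_add' f g := by
    funext ω
    rw [Submodule.coe_add]
    exact sum_siteLaplacian_add_sphereConfig (hs _ f.2) (hs _ g.2) ω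
  map_smul' c f := by
    funext ω
    rw [Submodule.coe_smul, RingHom.id_apply]
    exact sum_siteLaplacian_const_mul_sphereConfig (hs _ f.2) c ω

/-- The subspace `P₀ = {f ∈ P | f(ω₀) = 0}` (kills the constant ambiguity). -/
def P0 : Submodule ℝ ((Λ → E) → ℝ) :=
  P ⊓ LinearMap.ker (LinearMap.proj ω₀ ∘ₗ restrictΩ E Λ)

omit [InnerProductSpace ℝ E] [FiniteDimensional ℝ E] [MeasurableSpace E] [BorelSpace E] [Fintype Λ] [DecidableEq Λ] in
/-- Membership in `P₀`. -/
theorem mem_P0 (f : (Λ → E) → ℝ) : f ∈ P0 P ω₀ ↔ f ∈ P ∧ f (fun n => (ω₀ n : E)) = 0 := by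
  simp [P0, LinearMap.mem_ker]

/-- `P₀` is finite-dimensional when `P` is. -/
instance [FiniteDimensional ℝ P] : FiniteDimensional ℝ (P0 P ω₀) := by
  unfold P0; infer_instance

/-- `T₀ f = (𝔏₀f)|_Ω` on `P₀`. -/
def T0 (hs : ∀ f ∈ P, ContDiff ℝ 2 f) : P0 P ω₀ →ₗ[ℝ] ((Λ → sphere (0 : E) 1) → ℝ) :=
  lapΩ P hs ∘ₗ Submodule.inclusion (inf_le_left : P0 P ω₀ ≤ P)

/-- `ρ₀ f = f|_Ω` on `P₀`. -/
def rho0 : P0 P ω₀ →ₗ[ℝ] ((Λ → sphere (0 : E) 1) → ℝ) := restrictΩ E Λ ∘ₗ (P0 P ω₀).subtype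

/-- `ρ f = f|_Ω` on `P`; its range is `V = P|_Ω`. -/
def rhoP : P →ₗ[ℝ] ((Λ → sphere (0 : E) 1) → ℝ) := restrictΩ E Λ ∘ₗ P.subtype

variable {P ω₀}

omit [MeasurableSpace E] [BorelSpace E] in
/-- Unfolding `T0`. -/
theorem T0_apply (hs : ∀ f ∈ P, ContDiff ℝ 2 f) (f : P0 P ω₀) (ω : Λ → sphere (0 : E) 1) :
    T0 P ω₀ hs f ω = ∑ k, siteLaplacian k (f : (Λ → E) → ℝ) (fun n => (ω n : E)) := rfl

omit [InnerProductSpace ℝ E] [FiniteDimensional ℝ E] [MeasurableSpace E] [BorelSpace E] [Fintype Λ] [DecidableEq Λ] in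
/-- Unfolding `rho0`. -/
theorem rho0_apply (f : P0 P ω₀) (ω : Λ → sphere (0 : E) 1) :
    rho0 P ω₀ f ω = (f : (Λ → E) → ℝ) (fun n => (ω n : E)) := rfl

omit [InnerProductSpace ℝ E] [FiniteDimensional ℝ E] [MeasurableSpace E] [BorelSpace E] [Fintype Λ] [DecidableEq Λ] in
/-- Unfolding `rhoP`. -/
theorem rhoP_apply (f : P) (ω : Λ → sphere (0 : E) 1) :
    rhoP P f ω = (f : (Λ → E) → ℝ) (fun n => (ω n : E)) := rfl

/-- **Same kernel**: on `P₀`, `𝔏₀f = 0` on `Ω` iff `f = 0` on `Ω` (⇒: the null space of `𝔏₀` is the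
constants, `SphereLatticeLuscherKernel`; ⇐: `𝔏₀` on `Ω` only sees the restriction), `dim E ≥ 2`. -/
theorem ker_T0_eq (h2 : 2 ≤ Module.finrank ℝ E) (hs : ∀ f ∈ P, ContDiff ℝ 2 f) :
    LinearMap.ker (T0 P ω₀ hs) = LinearMap.ker (rho0 P ω₀) := by
  ext f
  simp only [LinearMap.mem_ker]
  have hf0 : (f : (Λ → E) → ℝ) (fun n => (ω₀ n : E)) = 0 := ((mem_P0 P ω₀ _).1 f.2).2
  have hsm : ContDiff ℝ 2 (f : (Λ → E) → ℝ) := hs _ ((mem_P0 P ω₀ _).1 f.2).1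
  constructor
  · intro h
    funext ω
    rw [rho0_apply, eq_of_sum_siteLaplacian_eq_zero h2 hsm (fun ω' => congrFun h ω') ω ω₀, hf0]
    rfl
  · intro h
    funext ω
    rw [T0_apply]
    exact sum_siteLaplacian_sphereConfig_eq_zero_of_forall (fun ω' => congrFun h ω') ω

/-- Hence `dim range T₀ = dim range ρ₀` (rank–nullity on `P₀`). -/
theorem finrank_range_T0_eq (h2 : 2 ≤ Module.finrank ℝ E) (hs : ∀ f ∈ P, ContDiff ℝ 2 f)
    [FiniteDimensional ℝ P] :
    Module.finrank ℝ (LinearMap.range (T0 P ω₀ hs)) =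
      Module.finrank ℝ (LinearMap.range (rho0 P ω₀)) := by
  have h1 := LinearMap.finrank_range_add_finrank_ker (T0 P ω₀ hs)
  have h3 := LinearMap.finrank_range_add_finrank_ker (rho0 P ω₀)
  rw [ker_T0_eq h2 hs] at h1
  omega

omit [FiniteDimensional ℝ E] [MeasurableSpace E] [BorelSpace E] [DecidableEq Λ] in
/-- Members of `V = P|_Ω` are continuous (restrictions of `C²` functionals). -/
theorem continuous_of_mem_range_rhoP (hs : ∀ f ∈ P, ContDiff ℝ 2 f)
    {w : (Λ → sphere (0 : E) 1) → ℝ} (hw : w ∈ LinearMap.range (rhoP P)) : Continuous w := by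
  obtain ⟨f, rfl⟩ := hw
  exact (hs _ f.2).continuous.comp continuous_sphereConfig

/-- The mean `v ↦ ∫ v dP` as a linear functional on `V = P|_Ω`. -/
def meanV (hs : ∀ f ∈ P, ContDiff ℝ 2 f) : LinearMap.range (rhoP P) →ₗ[ℝ] ℝ where
  toFun v := ∫ ω, (v : (Λ → sphere (0 : E) 1) → ℝ) ω ∂Measure.pi (fun _ : Λ => (volume : Measure E).toSphere)
  map_add' v w := by
    show ∫ ω, ((v : (Λ → sphere (0 : E) 1) → ℝ) ω + (w : (Λ → sphere (0 : E) 1) → ℝ) ω) ∂_ = _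
    exact integral_add (integrable_pi_toSphere_of_continuous (continuous_of_mem_range_rhoP hs v.2))
      (integrable_pi_toSphere_of_continuous (continuous_of_mem_range_rhoP hs w.2))
  map_smul' c v := by
    show ∫ ω, c * (v : (Λ → sphere (0 : E) 1) → ℝ) ω ∂_ = c * _
    exact integral_const_mul c _

omit [DecidableEq Λ] in
/-- Unfolding `meanV`. -/
theorem meanV_apply (hs : ∀ f ∈ P, ContDiff ℝ 2 f) (v : LinearMap.range (rhoP P)) :
    meanV hs v = ∫ ω, (v : (Λ → sphere (0 : E) 1) → ℝ) ω
      ∂Measure.pi (fun _ : Λ => (volume : Measure E).toSphere) := rfl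

variable (P ω₀) in
/-- Evaluation at `ω₀` as a functional on `V`. -/
def evalV : LinearMap.range (rhoP P) →ₗ[ℝ] ℝ :=
  LinearMap.proj ω₀ ∘ₗ (LinearMap.range (rhoP P)).subtype

omit [InnerProductSpace ℝ E] [FiniteDimensional ℝ E] [MeasurableSpace E] [BorelSpace E] [Fintype Λ] [DecidableEq Λ] in
/-- Unfolding `evalV`. -/
theorem evalV_apply (v : LinearMap.range (rhoP P)) :
    evalV P ω₀ v = (v : (Λ → sphere (0 : E) 1) → ℝ) ω₀ := rfl

/-- The constant `1 ∈ V`. -/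
def oneV (h1 : (fun _ => (1 : ℝ)) ∈ P) : LinearMap.range (rhoP P) :=
  ⟨rhoP P ⟨fun _ => 1, h1⟩, LinearMap.mem_range_self _ _⟩

omit [InnerProductSpace ℝ E] [FiniteDimensional ℝ E] [MeasurableSpace E] [BorelSpace E] [Fintype Λ] [DecidableEq Λ] in
/-- The underlying function of `oneV` is the constant `1`. -/
theorem coe_oneV (h1 : (fun _ => (1 : ℝ)) ∈ P) :
    (oneV h1 : (Λ → sphere (0 : E) 1) → ℝ) = fun _ => 1 := rfl

omit [DecidableEq Λ] in
/-- The mean of the constant `1` is `P(univ) ≠ 0` (`dim E ≥ 1`). -/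
theorem meanV_oneV_ne_zero [Nontrivial E] (hs : ∀ f ∈ P, ContDiff ℝ 2 f)
    (h1 : (fun _ => (1 : ℝ)) ∈ P) : meanV hs (oneV h1) ≠ 0 := by
  rw [meanV_apply, coe_oneV, integral_const, smul_eq_mul, mul_one]
  exact pi_toSphere_univ_toReal_ne_zero

omit [InnerProductSpace ℝ E] [FiniteDimensional ℝ E] [MeasurableSpace E] [BorelSpace E] [Fintype Λ] [DecidableEq Λ] in
/-- The constant `1` evaluates to `1` at `ω₀`. -/
theorem evalV_oneV (h1 : (fun _ => (1 : ℝ)) ∈ P) : evalV P ω₀ (oneV h1) = 1 := rfl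

/-- `range T₀ ⊆` mean-zero part of `V` (`𝔏₀f|_Ω ∈ P|_Ω` by stability, and `∫ 𝔏₀f dP = 0`). -/
theorem range_T0_le [Nontrivial E] (hs : ∀ f ∈ P, ContDiff ℝ 2 f)
    (hΔ : ∀ f ∈ P, ∃ g ∈ P, ∀ ω : Λ → sphere (0 : E) 1,
      ∑ k, siteLaplacian k f (fun n => (ω n : E)) = g (fun n => (ω n : E))) :
    LinearMap.range (T0 P ω₀ hs) ≤
      (LinearMap.ker (meanV hs)).map (LinearMap.range (rhoP P)).subtype := by
  rintro w ⟨f, rfl⟩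
  have hfP : (f : (Λ → E) → ℝ) ∈ P := ((mem_P0 P ω₀ _).1 f.2).1
  obtain ⟨g, hgP, hg⟩ := hΔ _ hfP
  have hmem : T0 P ω₀ hs f ∈ LinearMap.range (rhoP P) :=
    ⟨⟨g, hgP⟩, by funext ω; rw [rhoP_apply, T0_apply]; exact (hg ω).symm⟩
  refine ⟨⟨T0 P ω₀ hs f, hmem⟩, ?_, rfl⟩
  show meanV hs ⟨T0 P ω₀ hs f, hmem⟩ = 0
  rw [meanV_apply]
  show ∫ ω, T0 P ω₀ hs f ω ∂_ = 0
  simp only [T0_apply]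
  exact integral_sum_siteLaplacian_eq_zero (hs _ hfP)

omit [InnerProductSpace ℝ E] [FiniteDimensional ℝ E] [MeasurableSpace E] [BorelSpace E] [Fintype Λ] [DecidableEq Λ] in
/-- `range ρ₀ =` the part of `V` vanishing at `ω₀`. -/
theorem range_rho0_eq :
    LinearMap.range (rho0 P ω₀) =
      (LinearMap.ker (evalV P ω₀)).map (LinearMap.range (rhoP P)).subtype := by
  apply le_antisymm
  · rintro w ⟨f, rfl⟩
    have hf := (mem_P0 P ω₀ _).1 f.2
    refine ⟨⟨rho0 P ω₀ f, ⟨⟨(f : (Λ → E) → ℝ), hf.1⟩, rfl⟩⟩, ?_, rfl⟩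
    show evalV P ω₀ ⟨rho0 P ω₀ f, _⟩ = 0
    rw [evalV_apply]
    exact hf.2
  · rintro w ⟨v, hv, rfl⟩
    obtain ⟨g, hg⟩ := v.2
    have hv' : (v : (Λ → sphere (0 : E) 1) → ℝ) ω₀ = 0 := hv
    have hg0 : (g : (Λ → E) → ℝ) ∈ P0 P ω₀ := by
      rw [mem_P0]
      refine ⟨g.2, ?_⟩
      rw [← hg] at hv'
      exact hv'
    exact ⟨⟨(g : (Λ → E) → ℝ), hg0⟩, hg⟩

omit [DecidableEq Λ] in
/-- The two kernels have the same dimension `dim V − 1`. -/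
theorem finrank_ker_meanV_eq [Nontrivial E] (hs : ∀ f ∈ P, ContDiff ℝ 2 f)
    (h1 : (fun _ => (1 : ℝ)) ∈ P) [FiniteDimensional ℝ P] :
    Module.finrank ℝ (LinearMap.ker (meanV hs)) = Module.finrank ℝ (LinearMap.ker (evalV P ω₀)) := by
  have ha := TrivializingMaps.finrank_ker_add_one_of_apply_ne_zero (meanV hs) (v := oneV h1)
    (meanV_oneV_ne_zero hs h1)
  have hb := TrivializingMaps.finrank_ker_add_one_of_apply_ne_zero (evalV P ω₀) (v := oneV h1)
    (by rw [evalV_oneV]; exact one_ne_zero)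
  omega

/-- **`range T₀` is exactly the mean-zero part of `V`** (`dim E ≥ 2`). -/
theorem range_T0_eq (h2 : 2 ≤ Module.finrank ℝ E) (hs : ∀ f ∈ P, ContDiff ℝ 2 f)
    (hΔ : ∀ f ∈ P, ∃ g ∈ P, ∀ ω : Λ → sphere (0 : E) 1,
      ∑ k, siteLaplacian k f (fun n => (ω n : E)) = g (fun n => (ω n : E)))
    (h1 : (fun _ => (1 : ℝ)) ∈ P) [FiniteDimensional ℝ P] :
    LinearMap.range (T0 P ω₀ hs) =
      (LinearMap.ker (meanV hs)).map (LinearMap.range (rhoP P)).subtype := by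
  haveI : Nontrivial E := Module.nontrivial_of_finrank_pos (R := ℝ) (by omega)
  refine Submodule.eq_of_le_of_finrank_eq (range_T0_le hs hΔ) ?_
  rw [Submodule.finrank_map_subtype_eq, finrank_range_T0_eq h2 hs, range_rho0_eq,
    Submodule.finrank_map_subtype_eq, finrank_ker_meanV_eq hs h1]

/-- **Solvability of `Σ_k ∂̃_k·∂̃_k f = g − ⨍g` inside a finite-dimensional `𝔏₀`-stable space of `C²`
functionals containing the constants** (`dim E ≥ 2`): for `g ∈ P` there is `f ∈ P`, vanishing at
`ω₀`, with `Σ_k ∂̃_k·∂̃_k f = g − (∫ g dP)/P(univ)` on the product of unit spheres. -/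
theorem exists_sum_siteLaplacian_eq_sub_mean (h2 : 2 ≤ Module.finrank ℝ E)
    (hs : ∀ f ∈ P, ContDiff ℝ 2 f)
    (hΔ : ∀ f ∈ P, ∃ g ∈ P, ∀ ω : Λ → sphere (0 : E) 1,
      ∑ k, siteLaplacian k f (fun n => (ω n : E)) = g (fun n => (ω n : E)))
    (h1 : (fun _ => (1 : ℝ)) ∈ P) [FiniteDimensional ℝ P] {g : (Λ → E) → ℝ} (hg : g ∈ P) :
    ∃ f ∈ P, f (fun n => (ω₀ n : E)) = 0 ∧ ∀ ω : Λ → sphere (0 : E) 1,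
      ∑ k, siteLaplacian k f (fun n => (ω n : E)) = g (fun n => (ω n : E)) -
        (∫ ω', g (fun n => (ω' n : E)) ∂Measure.pi (fun _ : Λ => (volume : Measure E).toSphere)) /
          ((Measure.pi fun _ : Λ => (volume : Measure E).toSphere) univ).toReal := by
  haveI : Nontrivial E := Module.nontrivial_of_finrank_pos (R := ℝ) (by omega)
  set Z : ℝ := ((Measure.pi fun _ : Λ => (volume : Measure E).toSphere) univ).toReal with hZ
  have hZ0 : Z ≠ 0 := pi_toSphere_univ_toReal_ne_zero
  set m : ℝ := (∫ ω', g (fun n => (ω' n : E))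
    ∂Measure.pi (fun _ : Λ => (volume : Measure E).toSphere)) / Z with hm
  -- the mean-zero element `g|_Ω − m·1` of `V`
  set v : LinearMap.range (rhoP P) :=
    ⟨rhoP P ⟨g, hg⟩, LinearMap.mem_range_self _ _⟩ - m • oneV h1 with hv
  have hmean1 : meanV hs (oneV h1) = Z := by
    rw [meanV_apply, coe_oneV, integral_const, smul_eq_mul, mul_one]
    rfl
  have hvA : v ∈ LinearMap.ker (meanV hs) := by
    rw [LinearMap.mem_ker, hv, map_sub, map_smul, hmean1, smul_eq_mul, sub_eq_zero, meanV_apply, hm,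
      div_mul_cancel₀ _ hZ0]
    rfl
  have hvR : (LinearMap.range (rhoP P)).subtype v ∈ LinearMap.range (T0 P ω₀ hs) := by
    rw [range_T0_eq h2 hs hΔ h1]; exact ⟨v, hvA, rfl⟩
  obtain ⟨f, hf⟩ := hvR
  have hfP := (mem_P0 P ω₀ _).1 f.2
  refine ⟨(f : (Λ → E) → ℝ), hfP.1, hfP.2, fun ω => ?_⟩
  have hω := congrFun hf ω
  rw [T0_apply] at hω
  rw [hω, hv]
  simp [rhoP_apply, coe_oneV, hm]

/-- **LÜSCHER'S POISSON PROBLEM IS SOLVABLE ORDER BY ORDER** inside any finite-dimensional space `P`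
of `C²` functionals containing the constants and stable under `𝔏₀` on the spheres (`dim E ≥ 2`):
for every source `R ∈ P` there are `X ∈ P` and a constant `c` (namely `c = −⨍R dP`) with
`−Σ_k ∂̃_k·∂̃_k X = R + c` on the product of unit spheres — unique up to an additive constant by
`luscher_poisson_unique`. -/
theorem exists_luscher_poisson_solution (h2 : 2 ≤ Module.finrank ℝ E) [Nonempty Λ]
    (hs : ∀ f ∈ P, ContDiff ℝ 2 f)
    (hΔ : ∀ f ∈ P, ∃ g ∈ P, ∀ ω : Λ → sphere (0 : E) 1,
      ∑ k, siteLaplacian k f (fun n => (ω n : E)) = g (fun n => (ω n : E)))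
    (h1 : (fun _ => (1 : ℝ)) ∈ P) [FiniteDimensional ℝ P] {R : (Λ → E) → ℝ} (hR : R ∈ P) :
    ∃ X ∈ P, ∃ c : ℝ, ∀ ω : Λ → sphere (0 : E) 1,
      -∑ k, siteLaplacian k X (fun n => (ω n : E)) = R (fun n => (ω n : E)) + c := by
  haveI : Nontrivial E := Module.nontrivial_of_finrank_pos (R := ℝ) (by omega)
  haveI : Nonempty (sphere (0 : E) 1) := (NormedSpace.sphere_nonempty.mpr zero_le_one).to_subtype
  obtain ⟨ω₀⟩ := (inferInstance : Nonempty (Λ → sphere (0 : E) 1))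
  have hnegR : (fun x => -R x) ∈ P := by
    have := P.neg_mem hR
    simpa [Pi.neg_def] using this
  obtain ⟨f, hfP, -, hf⟩ := exists_sum_siteLaplacian_eq_sub_mean (ω₀ := ω₀) h2 hs hΔ h1 hnegR
  refine ⟨f, hfP, (∫ ω', -R (fun n => (ω' n : E))
    ∂Measure.pi (fun _ : Λ => (volume : Measure E).toSphere)) /
      ((Measure.pi fun _ : Λ => (volume : Measure E).toSphere) univ).toReal, fun ω => ?_⟩
  rw [hf ω]
  ring

end Solver

end Summit.Ventures.LatticeQCDFlow.Exactness
end
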